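import Summits.HodgeConjecture.HodgeConjecture.Theorems.PadicSemiregularLiftFormalLiftingFromClassLiftingHuAssembly
import Literature.AlgebraicGeometry.Crystalline.HuComplexesHighWeight
import Literature.AlgebraicGeometry.Crystalline.HuComplexesDivision
import Literature.AlgebraicGeometry.Crystalline.DeRhamComplexTorsionFree
import Literature.AlgebraicGeometry.Crystalline.StaircaseHypercohomologyTorsionFree
import Literature.AlgebraicGeometry.KTheory.HuHypercohomologyCriteria

/-!
# `FormalLiftingFromClassLifting` (stmt-HodgeConjecture-13825) · line `hu` · per-model closure from the LOW weights, and relative curves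

The componentwise assembly `HuLine.stepClassLifting_of_hu` (`…HuAssembly`) derives step class lifting —
and hence, with hypothesis (⋆), `LiftsFormally 𝒳 E₁` — for ONE smooth proper model `𝒳/W(k)` of relative
dimension `d` from X. Hu's two `K₀`-claims (`KTheory.HuKZeroKernelPresentation`,
`KTheory.HuKZeroLiftingCriterion`, arXiv:2507.12458 Cor. 10.5 (i) / Thm. 1.2) and the two coherent lattice
statements: (S) the odd reductions `ℍ^{2r-1}(p^{r,1}_{r,N+3}Ω•) → ℍ^{2r-1}(p^{r,1}_{r,N+2}Ω•)` are onto for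
ALL `1 ≤ r < p`, and (T) compatible even families killed by a non-zero integer vanish for `1 ≤ r < d`.

This file records two consequences that need NO global hypothesis:

* `liftsFormally_of_huFacts_of_lowWeights` — the weights `r ≥ d` of (S) are automatic
  (`Crystalline.huHReduce_surjective_of_dim_le`, the high-weight corner: `ℍ^{2r-1}` is the top
  hypercohomology degree of a complex of amplitude `[0, r-1]` supported on the `d`-dimensional special
  fibre, so the reductions are right exact there), hence per model only the LOW weights `1 ≤ r < d` of
  (S) and (T) are needed — exactly the part governed by the degeneration of Hodge–de Rham;
* `liftsFormally_of_huFacts_of_dim_le_one` — for RELATIVE CURVES (`d ≤ 1`; also `d = 0`) there are no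
  low weights at all: granted the two Hu claims, every finite locally free `E₁` on the special fibre
  satisfying (⋆) whose rational class pro-lifts lifts formally — no projectivity, no torsion-freeness of
  Hodge cohomology and no Hodge–de Rham degeneration enter (the crux's remaining hypotheses are idle in
  relative dimension `≤ 1`).

For relative surfaces (`d = 2`) only the weight `r = 1` remains (`liftsFormally_of_huFacts_of_dim_le_two_of_weightOne`):
(S)₁/(T)₁ are Bockstein statements about `p^{1,1}_{1,N}Ω• = [p𝒪/p^{N}𝒪]`, i.e. about `Hᵇ(𝒳, 𝒪)/p^{N-1}`,
and follow from `p`-torsion-freeness of `Hᵇ(𝒳, 𝒪)` alone (`Crystalline.sheafHypercohomology_staircaseTrunc_one_torsionFree`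
+ the hypercohomology criteria of the line) — Deligne's degeneration theorem is not needed for `d ≤ 2`.

Everything is CONDITIONAL on the two Hu claims (hypotheses `hK`, `hL`); nothing else is assumed.
-/

set_option linter.dupNamespace false

namespace Summit.HodgeConjecture.HodgeConjecture.Theorems.FormalLiftingFromClassLifting.HuLine

open CategoryTheory AlgebraicGeometry Limits
open Literature.AlgebraicGeometry Literature.AlgebraicGeometry.Motives
open Literature.AlgebraicGeometry.Motives.WittScheme Literature.AlgebraicGeometry.KTheory
open Summit.HodgeConjecture.HodgeConjecture.Theses.PadicSemiregularLift

noncomputable section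

variable {p : ℕ} [Fact p.Prime] {k : Type} [Field k] [CharP k p] [PerfectRing k p] {d : ℕ}
  (𝒳 : SchemeOver (WittVector p k))

/-- **Per-model closure of the `hu` line from the low weights only.** For `𝒳/W(k)` a smooth proper
model of relative dimension `d` with `d + 6 ≤ p`, granted X. Hu's two `K₀`-claims
(`KTheory.HuKZeroKernelPresentation`, `KTheory.HuKZeroLiftingCriterion`): if (S) the odd reductions
`ℍ^{2r-1}(p^{r,1}_{r,N+3}Ω•) → ℍ^{2r-1}(p^{r,1}_{r,N+2}Ω•)` are onto for the LOW weights `1 ≤ r < d` and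
(T) for `1 ≤ r < d` every compatible family in `N ↦ ℍ^{2r}(p^{r,1}_{r,N+2}Ω•)` killed by a non-zero
integer vanishes, then every finite locally free `E₁` on the special fibre satisfying (⋆) (class lifts
imply object lifts, level by level) whose rational `K₀`-class pro-lifts lifts formally. The weights
`d ≤ r < p` of (S) are supplied by `Crystalline.huHReduce_surjective_of_dim_le`
(`huHReduce_odd_surjective_of_lowWeights`). CONDITIONAL on the two Hu claims.
[cite: Hu2025TruncatedWitt, Thm. 1.2, Cor. 10.5 (i), Prop. 9.6] -/
theorem liftsFormally_of_huFacts_of_lowWeights (hK : HuKZeroKernelPresentation)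
    (hL : HuKZeroLiftingCriterion) (h𝒳 : IsSmoothProperModel d 𝒳) (hp : d + 6 ≤ p)
    (hS : ∀ (N r : ℕ), 1 ≤ r → r < d →
      Function.Surjective (huHReduce p k 𝒳 r 1 (Nat.le_succ (N + 2)) (2 * (r : ℤ) - 1)))
    (hT : ∀ (r : ℕ), 1 ≤ r → r < d → ∀ (L : ℤ), L ≠ 0 →
      ∀ o : (∀ N : ℕ, huH p k 𝒳 r 1 (N + 2) (2 * (r : ℤ))),
        (∀ N, huHReduce p k 𝒳 r 1 (Nat.le_succ (N + 2)) _ (o (N + 1)) = o N) →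
        (∀ N, L • o N = 0) → ∀ N, o N = 0)
    {E₁ : (specialFibre 𝒳).left.Modules} (hE₁ : IsFiniteLocallyFree E₁)
    (hstar : ∀ (n : ℕ) (F : (thickening 𝒳 (n + 1)).left.Modules) (hF : IsFiniteLocallyFree F),
      Nonempty ((Scheme.Modules.pullback (specialFibreToThickening 𝒳 n)).obj F ≅ E₁) →
      (∃ y : KZero (thickening 𝒳 (n + 2)).left,
        KZero.map (thickeningMap 𝒳 (Nat.le_succ (n + 1))) y = KZero.of F hF) →
      ∃ F' : (thickening 𝒳 (n + 2)).left.Modules, IsFiniteLocallyFree F' ∧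
        Nonempty ((Scheme.Modules.pullback (thickeningMap 𝒳 (Nat.le_succ (n + 1)))).obj F' ≅ F))
    (hξ : ∃ ξ : ContinuousKZeroRat (Ideal.span {(p : WittVector p k)}) 𝒳,
      KZeroRat.map (Crystalline.specialFibreToTower 𝒳)
        (ContinuousKZeroRat.specialFibre (Ideal.span {(p : WittVector p k)}) 𝒳 ξ) =
        KZeroRat.of E₁ hE₁) :
    LiftsFormally 𝒳 E₁ :=
  Glue.liftsFormally_of_stepClassLifting hE₁ hstar
    (stepClassLifting_of_hu 𝒳 hK hL h𝒳 hp
      (fun N r hr _ => Crystalline.huHReduce_odd_surjective_of_lowWeights h𝒳 hS N r hr) hT hE₁ hξ)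

/-- **Relative curves: the `hu` line closes from the two Hu claims alone.** For `𝒳/W(k)` a smooth
proper model of relative dimension `d ≤ 1` with `d + 6 ≤ p`, granted X. Hu's two `K₀`-claims, every
finite locally free `E₁` on the special fibre satisfying (⋆) whose rational `K₀`-class pro-lifts lifts
formally: there are no weights `1 ≤ r < d`, so neither lattice statement has content — projectivity,
torsion-freeness of Hodge cohomology and Hodge–de Rham degeneration are not used. CONDITIONAL on the
two Hu claims. [cite: Hu2025TruncatedWitt, Thm. 1.2, Cor. 10.5 (i)] -/
theorem liftsFormally_of_huFacts_of_dim_le_one :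
    KTheory.HuKZeroLiftingCriterion → KTheory.HuKZeroKernelPresentation →
    ∀ (p : ℕ) [Fact p.Prime] (k : Type) [Field k] [CharP k p] [PerfectRing k p] (d : ℕ)
      (𝒳 : SchemeOver (WittVector p k)), IsSmoothProperModel d 𝒳 → d ≤ 1 → d + 6 ≤ p →
      ∀ (E₁ : (specialFibre 𝒳).left.Modules) (hE₁ : IsFiniteLocallyFree E₁),
      (∀ (n : ℕ) (F : (thickening 𝒳 (n + 1)).left.Modules) (hF : IsFiniteLocallyFree F),
        Nonempty ((Scheme.Modules.pullback (specialFibreToThickening 𝒳 n)).obj F ≅ E₁) →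
        (∃ y : KTheory.KZero (thickening 𝒳 (n + 2)).left,
          KTheory.KZero.map (thickeningMap 𝒳 (Nat.le_succ (n + 1))) y = KTheory.KZero.of F hF) →
        ∃ F' : (thickening 𝒳 (n + 2)).left.Modules, IsFiniteLocallyFree F' ∧
          Nonempty ((Scheme.Modules.pullback (thickeningMap 𝒳 (Nat.le_succ (n + 1)))).obj F' ≅ F)) →
      (∃ ξ : KTheory.ContinuousKZeroRat (Ideal.span {(p : WittVector p k)}) 𝒳,
        KTheory.KZeroRat.map (Crystalline.specialFibreToTower 𝒳)
          (KTheory.ContinuousKZeroRat.specialFibre (Ideal.span {(p : WittVector p k)}) 𝒳 ξ) =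
          KTheory.KZeroRat.of E₁ hE₁) →
      LiftsFormally 𝒳 E₁ :=
  fun hL hK _ _ _ _ _ _ _ 𝒳 h𝒳 hd hp _ hE₁ hstar hξ =>
    liftsFormally_of_huFacts_of_lowWeights 𝒳 hK hL h𝒳 hp (fun _ _ hr hrd => absurd hrd (by omega))
      (fun _ hr hrd => absurd hrd (by omega)) hE₁ hstar hξ

/-- **Relative surfaces: only the weight `r = 1` remains.** For `𝒳/W(k)` a smooth proper model of
relative dimension `d ≤ 2` with `d + 6 ≤ p`, granted X. Hu's two `K₀`-claims, the two weight-one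
Bockstein statements — (S)₁ the reductions `ℍ¹(p^{1,1}_{1,N+3}Ω•) → ℍ¹(p^{1,1}_{1,N+2}Ω•)` are onto and
(T)₁ compatible families in `N ↦ ℍ²(p^{1,1}_{1,N+2}Ω•)` killed by a non-zero integer vanish (both about the
one-column complexes `[p𝒪/p^{N}𝒪]`, i.e. about `Hᵇ(𝒳, 𝒪)/p^{N-1}`; they follow from `p`-torsion-freeness
of `Hᵇ(𝒳, 𝒪)`) — give formal lifting of every finite locally free `E₁` satisfying (⋆) whose rational
class pro-lifts. No Hodge–de Rham degeneration is involved in relative dimension `≤ 2`. CONDITIONAL on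
the two Hu claims. [cite: Hu2025TruncatedWitt, Thm. 1.2, Cor. 10.5 (i)] -/
theorem liftsFormally_of_huFacts_of_dim_le_two_of_weightOne :
    KTheory.HuKZeroLiftingCriterion → KTheory.HuKZeroKernelPresentation →
    ∀ (p : ℕ) [Fact p.Prime] (k : Type) [Field k] [CharP k p] [PerfectRing k p] (d : ℕ)
      (𝒳 : SchemeOver (WittVector p k)), IsSmoothProperModel d 𝒳 → d ≤ 2 → d + 6 ≤ p →
      (∀ N : ℕ, Function.Surjective (KTheory.huHReduce p k 𝒳 1 1 (Nat.le_succ (N + 2)) 1)) →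
      (∀ (L : ℤ), L ≠ 0 → ∀ o : (∀ N : ℕ, KTheory.huH p k 𝒳 1 1 (N + 2) 2),
        (∀ N, KTheory.huHReduce p k 𝒳 1 1 (Nat.le_succ (N + 2)) 2 (o (N + 1)) = o N) →
        (∀ N, L • o N = 0) → ∀ N, o N = 0) →
      ∀ (E₁ : (specialFibre 𝒳).left.Modules) (hE₁ : IsFiniteLocallyFree E₁),
      (∀ (n : ℕ) (F : (thickening 𝒳 (n + 1)).left.Modules) (hF : IsFiniteLocallyFree F),
        Nonempty ((Scheme.Modules.pullback (specialFibreToThickening 𝒳 n)).obj F ≅ E₁) →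
        (∃ y : KTheory.KZero (thickening 𝒳 (n + 2)).left,
          KTheory.KZero.map (thickeningMap 𝒳 (Nat.le_succ (n + 1))) y = KTheory.KZero.of F hF) →
        ∃ F' : (thickening 𝒳 (n + 2)).left.Modules, IsFiniteLocallyFree F' ∧
          Nonempty ((Scheme.Modules.pullback (thickeningMap 𝒳 (Nat.le_succ (n + 1)))).obj F' ≅ F)) →
      (∃ ξ : KTheory.ContinuousKZeroRat (Ideal.span {(p : WittVector p k)}) 𝒳,
        KTheory.KZeroRat.map (Crystalline.specialFibreToTower 𝒳)
          (KTheory.ContinuousKZeroRat.specialFibre (Ideal.span {(p : WittVector p k)}) 𝒳 ξ) =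
          KTheory.KZeroRat.of E₁ hE₁) →
      LiftsFormally 𝒳 E₁ := by
  intro hL hK p _ k _ _ _ d 𝒳 h𝒳 hd hp hS₁ hT₁ E₁ hE₁ hstar hξ
  refine liftsFormally_of_huFacts_of_lowWeights 𝒳 hK hL h𝒳 hp (fun N r hr hrd => ?_)
    (fun r hr hrd => ?_) hE₁ hstar hξ
  · obtain rfl : r = 1 := by omega
    exact hS₁ N
  · obtain rfl : r = 1 := by omega
    exact hT₁

/-! ### Relative surfaces: the weight-one Bocksteins from `Hᵇ(𝒳, 𝒪)` -/

open Literature.Algebra.Homology in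
omit [PerfectRing k p] in
/-- **The inclusion-induced maps `ℍⁱ(σ≤(r-1) p^{(r-•)N}Ω•) → ℍⁱ(σ≤(r-1) p^{(r-•)M}Ω•)` (`M ≤ N`) have
image divisible by `p^{N-M}`** for a smooth proper model `𝒳/W(k)`: on the truncations `σ≤(r-1)` the
inclusion is `p^{N-M}` times a chain map (`Crystalline.deRhamStaircaseHatTruncMul_comp_TruncLE`, the
multiplication `(× p^{N-M}) : σ≤ p^{ê}Ω• ⥲ σ≤ p^{(r-•)N}Ω•` being an isomorphism because the `Ωʲ_{𝒳/W}`
have no `p`-torsion, `Crystalline.isIso_deRhamStaircaseHatTruncMul` +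
`IsSmoothProperModel.mono_p_smul_id_algebraicDeRhamComplex_X`), and hypercohomology is additive.
This is hypothesis (iii) of `KTheory.HuStaircase.huH_family_eq_zero` (the general-`r` form is
`KTheory/HuHypercohomologyDivisibility`; it is consumed here at `r = 1` only). [folklore] -/
theorem staircaseHLE_eq_pow_smul (h𝒳 : IsSmoothProperModel d 𝒳) (r : ℕ) {M N : ℕ} (h : M ≤ N)
    (i : ℤ) (x : HuStaircase.staircaseH p k 𝒳 r N i) :
    ∃ y : HuStaircase.staircaseH p k 𝒳 r M i,
      HuStaircase.staircaseHLE p k 𝒳 r h i x = ((p : ℤ) ^ (N - M)) • y := by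
  haveI : ∀ j, Mono ((p : ℤ) • 𝟙 ((Crystalline.algebraicDeRhamComplex 𝒳).X j)) :=
    h𝒳.mono_p_smul_id_algebraicDeRhamComplex_X
  haveI := Crystalline.isIso_deRhamStaircaseHatTruncMul 𝒳 (p : ℤ) r M N
  obtain ⟨x', rfl⟩ := (HyperExt.map_bijective_of_isIso
    (X := Crystalline.constantSheafInt (Opens.grothendieckTopology 𝒳.left))
    (Crystalline.deRhamStaircaseHatTruncMul 𝒳 (p : ℤ) r M N) i).2 x
  refine ⟨HyperExt.map (Crystalline.deRhamStaircaseHatTruncLE 𝒳 (p : ℤ) r h) i x', ?_⟩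
  rw [← HyperExt.map_comp, Crystalline.deRhamStaircaseHatTruncMul_comp_TruncLE,
    HyperExt.map_zsmul_hom]

/-- **Relative surfaces: the `hu` line closes from the two Hu claims and `p`-torsion-free
`Hᵇ(𝒳, 𝒪)`.** For `𝒳/W(k)` a smooth proper model of relative dimension `d ≤ 2` with `d + 6 ≤ p` whose
coherent cohomology groups `Hᵇ(𝒳, 𝒪)` have no `p`-torsion, granted X. Hu's two `K₀`-claims
(`KTheory.HuKZeroLiftingCriterion`, `KTheory.HuKZeroKernelPresentation`, arXiv:2507.12458 Thm. 1.2 /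
Cor. 10.5 (i)), every finite locally free `E₁` on the special fibre satisfying (⋆) (class lifts imply
object lifts, level by level) whose rational `K₀`-class pro-lifts lifts formally. The weight-one
lattice statements (S)₁/(T)₁ of `liftsFormally_of_huFacts_of_dim_le_two_of_weightOne` are
DISCHARGED: the groups `ℍⁱ(σ≤0 p^{(1-•)M}Ω•) = Hⁱ(𝒳, p^{M}𝒪)` have no `p`-torsion
(`Crystalline.sheafHypercohomology_staircaseTrunc_one_torsionFree`, from `hO` alone), so Hu's odd
reductions are onto (`KTheory.HuStaircase.huHReduce_surjective_of_torsionFree`) and compatible even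
families killed by a non-zero integer vanish (`KTheory.HuStaircase.huH_family_eq_zero`, with the
divisibility `staircaseHLE_eq_pow_smul`). Neither projectivity, nor `Hᵇ(𝒳, Ω¹)`, nor Hodge–de Rham
degeneration (Deligne) is used in relative dimension `≤ 2`. CONDITIONAL on the two Hu claims only.
[cite: Hu2025TruncatedWitt, Thm. 1.2, Cor. 10.5 (i)] -/
theorem liftsFormally_of_huFacts_of_dim_le_two :
    KTheory.HuKZeroLiftingCriterion → KTheory.HuKZeroKernelPresentation →
    ∀ (p : ℕ) [Fact p.Prime] (k : Type) [Field k] [CharP k p] [PerfectRing k p] (d : ℕ)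
      (𝒳 : SchemeOver (WittVector p k)), IsSmoothProperModel d 𝒳 → d ≤ 2 → d + 6 ≤ p →
      (∀ (b : ℕ) (x : structureSheafCohomology 𝒳.left b), (p : ℤ) • x = 0 → x = 0) →
      ∀ (E₁ : (specialFibre 𝒳).left.Modules) (hE₁ : IsFiniteLocallyFree E₁),
      (∀ (n : ℕ) (F : (thickening 𝒳 (n + 1)).left.Modules) (hF : IsFiniteLocallyFree F),
        Nonempty ((Scheme.Modules.pullback (specialFibreToThickening 𝒳 n)).obj F ≅ E₁) →
        (∃ y : KTheory.KZero (thickening 𝒳 (n + 2)).left,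
          KTheory.KZero.map (thickeningMap 𝒳 (Nat.le_succ (n + 1))) y = KTheory.KZero.of F hF) →
        ∃ F' : (thickening 𝒳 (n + 2)).left.Modules, IsFiniteLocallyFree F' ∧
          Nonempty ((Scheme.Modules.pullback (thickeningMap 𝒳 (Nat.le_succ (n + 1)))).obj F' ≅ F)) →
      (∃ ξ : KTheory.ContinuousKZeroRat (Ideal.span {(p : WittVector p k)}) 𝒳,
        KTheory.KZeroRat.map (Crystalline.specialFibreToTower 𝒳)
          (KTheory.ContinuousKZeroRat.specialFibre (Ideal.span {(p : WittVector p k)}) 𝒳 ξ) =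
          KTheory.KZeroRat.of E₁ hE₁) →
      LiftsFormally 𝒳 E₁ := by
  intro hL hK p _ k _ _ _ d 𝒳 h𝒳 hd hp hO E₁ hE₁ hstar hξ
  have hp0 : ((p : ℕ) : ℤ) ≠ 0 := by exact_mod_cast (Fact.out : p.Prime).ne_zero
  -- `ℍⁱ(σ≤0 p^{(1-•)M}Ω•) = Hⁱ(𝒳, p^{M}𝒪)` has no `p`-torsion, from `hO` alone
  have htf : ∀ (M : ℕ) (i : ℤ) (x : HuStaircase.staircaseH p k 𝒳 1 M i), (p : ℤ) • x = 0 → x = 0 :=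
    fun M i x hx =>
      Crystalline.sheafHypercohomology_staircaseTrunc_one_torsionFree 𝒳 h𝒳 hO M i hp0 x hx
  refine liftsFormally_of_huFacts_of_dim_le_two_of_weightOne hL hK p k d 𝒳 h𝒳 hd hp
    (fun N => ?_) ?_ E₁ hE₁ hstar hξ
  · -- (S)₁: the odd reductions are onto (torsion-freeness of `ℍ²` at level `N + 2`)
    exact HuStaircase.huHReduce_surjective_of_torsionFree p k 𝒳 1 (show 1 ≤ N + 2 by omega)
      (Nat.le_succ (N + 2)) 1 2 (by norm_num) (htf (N + 2) 2)
  · -- (T)₁: compatible even families killed by a non-zero integer vanish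
    exact HuStaircase.huH_family_eq_zero p k 𝒳 1 2 (htf 1 2)
      (fun N => HuStaircase.staircaseHπ_surjective_of_torsionFree p k 𝒳 1
        (show 1 ≤ N + 2 by omega) 2 3 rfl (htf (N + 2) 3))
      (fun N x => staircaseHLE_eq_pow_smul 𝒳 h𝒳 1 (show 1 ≤ N + 2 by omega) 2 x)

end

end Summit.HodgeConjecture.HodgeConjecture.Theorems.FormalLiftingFromClassLifting.HuLine
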